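import Summits.BirchSwinnertonDyer.BirchSwinnertonDyer.Theorems.ThetaPartnerAtTwoSignedKatoUpToAtTwoHondaLogCharSumsOne
import Summits.BirchSwinnertonDyer.Rank1Residual.Additive.KobayashiTowerPoints
import HarnessLib

/-!
# Route `ThetaPartnerAtTwo` (TP2), crux K3 `SignedKatoDivisibilityUpToAtTwo` (item stmt-BirchSwinnertonDyer-20308), line `colemanrat` —
# (R3) part 6: the character sums of the PLUS LOGARITHM `3(ℓ_m^{(a)} + ℓ_m^{(−a)}) − 2ℓ_1^{(a)}` for NON-primitive characters
# (imprimitive lifts of primitive `χ_c`, and the trivial character), in the lead's currency (`ℚ̄_p = PadicAlgCl p`, `ζ_j = zeta p j`)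

Width seat `bsd-wall-tp2-p2x-w2` g5 (cell `bsd-wall`). HONEST FRAMING: theorems only (no definition, no named fact, no instance,
no `sorry`); local cyclotomic algebra; nothing about any curve; closes no item; K3 is NOT settled and BSD is NOT proved by any of this.

## What is here

The lead's `HondaLog.sum_mul_plusLog_eq` (`…HondaLogCharSum`, Kobayashi Prop. 8.26 un-normalised) evaluates
`Σ_a ψ(a)·(3(ℓ_m^{(a)} + ℓ_m^{(−a)}) − 2(ζ_1^a − 1))` — the character sum of the logarithm `3(ℓ_m + σℓ_m) − 2ℓ_1` of the plus Honda point
`d_{m−2} = 3•(c_m + σ•c_m) − 2•c_1` at `2` (`…LocalTwoPlusPoints`) — for PRIMITIVE `ψ` modulo `p^m`. The character-value socket CORE_χ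
quantifies over ALL (even) characters modulo `2^{n+2}`, so the same sum is needed for the lift `ψ = χ_c ∘ (ℤ/p^m → ℤ/p^c)` of a
primitive `χ_c` of lower level `p^c` and for `ψ = 1`. Instantiating the generic theorems of `…HondaLogCharSumsEll` / `…HondaLogCharSumsOne`
(ns `HondaLogChi`) at `ζ := zeta p m` (`ζ^{p^{2k}} = zeta p (m − 2k)`, `zeta_pow_sq_pow`):

* `sum_changeLevel_mul_plusLog_eq` — `2 ≤ c`, `m = c + 2k`: the sum equals `3(1 + ψ(−1))·(−1)^k p^k·τ(χ_c)`,
  `τ(χ_c) = gaussSum χ_c (zmodChar (p^c) ζ_c)` the primitive Gauss sum at level `p^c` (the same term as in the lead's file by proof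
  irrelevance of the `ζ_c^{p^c} = 1` witness; the `ζ_1`-term dies: `c ≥ 2`);
* `sum_changeLevel_mul_plusLog_eq_zero` — `2 ≤ c ≤ m`, `m − c` odd: the sum is `0`;
* `sum_one_mul_plusLog_eq` — `ψ = 1`, `m = 2k + 2`: the sum equals `−6φ(p^m)·Σ_{i≤k}(−1)^i p^{−i} + 2p^{m−1} + 2φ(p^m)`
  (trace of `ℓ_m` from `sum_one_mul_ellConj_even`, Ramanujan sum `Σ_{a unit} ζ_1^a = −p^{m−1}`).
At `p = 2` (conductors `2^c`, `c ≥ 3` for even non-trivial characters; `c = 2` is the odd character mod `4`) this, together with the lead's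
primitive case, covers every even character of `(ℤ/2^{n+2})ˣ`, as CORE_χ requires.

References: [Kobayashi2003] §8.4, Prop. 8.26, proof of Thm. 6.3 (pp. 24–25); [Washington1997] Lemma 4.7–4.8.
-/

set_option autoImplicit false
-- the Theorems namespace of this sub repeats the summit name by design (D-0017 nested layout)
set_option linter.dupNamespace false

noncomputable section

open scoped Classical

open DirichletCharacter AddChar Finset Summit.BirchSwinnertonDyer.Rank1Residual.Additive
  Summit.BirchSwinnertonDyer.Rank1Residual.Additive.PadicCyclotomicTower Summit.BirchSwinnertonDyer.Rank1Residual.Additive.BallEval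

namespace Summit.BirchSwinnertonDyer.BirchSwinnertonDyer.Theorems.SignedKatoOffTwo.HondaLogChi

variable {p : ℕ} [hp : Fact p.Prime]

/-- The twisted logarithm in `zeta`-currency is the generic conjugate expression at `ζ := zeta p m`:
`Σ_{k<m} (−1)^k (ζ_{m−2k}^a − 1)/p^k = Σ_{k<m} (−1)^k ((ζ_m^{p^{2k}})^a − 1)/p^k`. [cite: Kobayashi2003, §8.4 (p. 17)] -/
theorem twistedEll_eq_ellConj (m a : ℕ) :
    ∑ k ∈ range m, (-1 : PadicAlgCl p) ^ k * (zeta p (m - 2 * k) ^ a - 1) / (p : PadicAlgCl p) ^ k =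
      ∑ k ∈ range m, (-1 : PadicAlgCl p) ^ k * ((zeta p m ^ p ^ (2 * k)) ^ a - 1) / (p : PadicAlgCl p) ^ k := by
  refine Finset.sum_congr rfl fun k _ ↦ ?_
  rw [zeta_pow_sq_pow]

/-- Reindexing `a ↦ −a`: `Σ_a ψ(a)·F((−a).val) = ψ(−1)·Σ_a ψ(a)·F(a.val)` for any Dirichlet character `ψ`. [folklore] -/
theorem sum_mul_apply_neg_val {n : ℕ} [NeZero n] {R : Type*} [CommRing R] (ψ : DirichletCharacter R n) (F : ℕ → R) :
    ∑ a : ZMod n, ψ a * F (-a).val = ψ (-1) * ∑ a : ZMod n, ψ a * F a.val := by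
  rw [Finset.mul_sum, ← Equiv.sum_comp (Equiv.neg (ZMod n))]
  refine Finset.sum_congr rfl fun a _ ↦ ?_
  rw [Equiv.neg_apply, neg_neg, ← mul_assoc, ← map_mul, neg_one_mul]

/-- `ζ_1 = ζ_m^{p^{m−1}}` for `m ≥ 1`. [folklore] -/
theorem zeta_one_eq_pow {m : ℕ} (hm : 1 ≤ m) : zeta p 1 = zeta p m ^ p ^ (m - 1) := by
  conv_lhs => rw [← zeta_add_pow (p := p) 1 (m - 1)]
  rw [Nat.add_sub_cancel' hm]

/-- **Plus-logarithm character sum for an imprimitive character, matching parity** (`m = c + 2k`, `χ_c` primitive of level `p^c`, `c ≥ 2`):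
`Σ_a ψ(a)·(3(ℓ_m^{(a)} + ℓ_m^{(−a)}) − 2(ζ_1^a − 1)) = 3(1 + ψ(−1))·(−1)^k p^k·τ(χ_c)` with `ψ = χ_c ∘ (ℤ/p^m → ℤ/p^c)` and
`τ(χ_c) = Σ_{b mod p^c} χ_c(b) ζ_c^b`. [cite: Kobayashi2003, Prop. 8.26 (pp. 24–25)] -/
theorem sum_changeLevel_mul_plusLog_eq {c m k₀ : ℕ} (hc : 2 ≤ c) (hm : m = c + 2 * k₀)
    (χc : DirichletCharacter (PadicAlgCl p) (p ^ c)) (hprim : χc.IsPrimitive) :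
    ∑ a : ZMod (p ^ m), changeLevel (pow_dvd_pow p (by omega : c ≤ m)) χc a *
        (3 * ((∑ k ∈ range m, (-1 : PadicAlgCl p) ^ k * (zeta p (m - 2 * k) ^ a.val - 1) / (p : PadicAlgCl p) ^ k) +
              ∑ k ∈ range m, (-1 : PadicAlgCl p) ^ k * (zeta p (m - 2 * k) ^ (-a).val - 1) / (p : PadicAlgCl p) ^ k) -
          2 * (zeta p 1 ^ a.val - 1)) =
      3 * (1 + changeLevel (pow_dvd_pow p (by omega : c ≤ m)) χc (-1)) *
        ((-1) ^ k₀ * (p : PadicAlgCl p) ^ k₀ *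
          gaussSum χc (zmodChar (p ^ c) ((isPrimitiveRoot_zeta p c).pow_eq_one))) := by
  have hcm : c ≤ m := by omega
  have h1m : 1 ≤ m := by omega
  set ψ := changeLevel (pow_dvd_pow p hcm) χc with hψ
  have hζ : IsPrimitiveRoot (zeta p m) (p ^ m) := isPrimitiveRoot_zeta p m
  have hpR : (p : PadicAlgCl p) ≠ 0 := Nat.cast_ne_zero.mpr hp.out.ne_zero
  have hne : ψ ≠ 1 := changeLevel_ne_one_of_isPrimitive (by omega) hcm χc hprim
  -- the main ℓ-sum (generic theorem at `ζ := zeta p m`)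
  have hζc : (zeta p m ^ p ^ (2 * k₀)) ^ p ^ c = 1 := by
    rw [zeta_pow_sq_pow, show m - 2 * k₀ = c by omega]; exact (isPrimitiveRoot_zeta p c).pow_eq_one
  have hA : ∑ a : ZMod (p ^ m), ψ a *
      ∑ k ∈ range m, (-1 : PadicAlgCl p) ^ k * (zeta p (m - 2 * k) ^ a.val - 1) / (p : PadicAlgCl p) ^ k =
      (-1) ^ k₀ * (p : PadicAlgCl p) ^ k₀ *
        gaussSum χc (zmodChar (p ^ c) ((isPrimitiveRoot_zeta p c).pow_eq_one)) := by
    simp_rw [twistedEll_eq_ellConj]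
    rw [hψ, sum_changeLevel_mul_ellConj (by omega) hm χc hprim hζ hζc hpR]
    congr 1
    simp only [gaussSum, zmodChar_apply, zeta_pow_sq_pow, show m - 2 * k₀ = c by omega]
  -- the reflected ℓ-sum
  have hB : ∑ a : ZMod (p ^ m), ψ a *
      ∑ k ∈ range m, (-1 : PadicAlgCl p) ^ k * (zeta p (m - 2 * k) ^ (-a).val - 1) / (p : PadicAlgCl p) ^ k =
      ψ (-1) * ((-1) ^ k₀ * (p : PadicAlgCl p) ^ k₀ *
        gaussSum χc (zmodChar (p ^ c) ((isPrimitiveRoot_zeta p c).pow_eq_one))) := by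
    rw [sum_mul_apply_neg_val ψ (fun x ↦ ∑ k ∈ range m,
      (-1 : PadicAlgCl p) ^ k * (zeta p (m - 2 * k) ^ x - 1) / (p : PadicAlgCl p) ^ k), hA]
  -- the `ζ_1`-term vanishes (`c ≥ 2`: level too high) and `Σ ψ = 0`
  have hC : ∑ a : ZMod (p ^ m), ψ a * (zeta p 1 ^ a.val - 1) = 0 := by
    simp_rw [mul_sub, Finset.sum_sub_distrib, mul_one, MulChar.sum_eq_zero_of_ne_one hne, sub_zero]
    rw [zeta_one_eq_pow h1m, hψ]
    exact sum_changeLevel_mul_pow_eq_zero_of_gt (by omega) hcm χc hprim hζ.pow_eq_one (by omega : m < m - 1 + c)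
  -- assemble
  have hsplit : ∀ a : ZMod (p ^ m), ψ a *
      (3 * ((∑ k ∈ range m, (-1 : PadicAlgCl p) ^ k * (zeta p (m - 2 * k) ^ a.val - 1) / (p : PadicAlgCl p) ^ k) +
            ∑ k ∈ range m, (-1 : PadicAlgCl p) ^ k * (zeta p (m - 2 * k) ^ (-a).val - 1) / (p : PadicAlgCl p) ^ k) -
        2 * (zeta p 1 ^ a.val - 1)) =
      3 * (ψ a * ∑ k ∈ range m, (-1 : PadicAlgCl p) ^ k * (zeta p (m - 2 * k) ^ a.val - 1) / (p : PadicAlgCl p) ^ k) +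
      3 * (ψ a * ∑ k ∈ range m, (-1 : PadicAlgCl p) ^ k * (zeta p (m - 2 * k) ^ (-a).val - 1) / (p : PadicAlgCl p) ^ k) -
      2 * (ψ a * (zeta p 1 ^ a.val - 1)) := fun a ↦ by ring
  rw [Finset.sum_congr rfl fun a _ ↦ hsplit a, Finset.sum_sub_distrib, Finset.sum_add_distrib, ← Finset.mul_sum,
    ← Finset.mul_sum, ← Finset.mul_sum, hA, hB, hC]
  ring

/-- **Plus-logarithm character sum for an imprimitive character, WRONG parity** (`2 ≤ c ≤ m`, `m − c` odd): the sum vanishes.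
[cite: Kobayashi2003, Prop. 8.26 (i) (p. 24)] -/
theorem sum_changeLevel_mul_plusLog_eq_zero {c m : ℕ} (hc : 2 ≤ c) (hcm : c ≤ m) (hodd : ∀ k : ℕ, m ≠ c + 2 * k)
    (χc : DirichletCharacter (PadicAlgCl p) (p ^ c)) (hprim : χc.IsPrimitive) :
    ∑ a : ZMod (p ^ m), changeLevel (pow_dvd_pow p hcm) χc a *
        (3 * ((∑ k ∈ range m, (-1 : PadicAlgCl p) ^ k * (zeta p (m - 2 * k) ^ a.val - 1) / (p : PadicAlgCl p) ^ k) +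
              ∑ k ∈ range m, (-1 : PadicAlgCl p) ^ k * (zeta p (m - 2 * k) ^ (-a).val - 1) / (p : PadicAlgCl p) ^ k) -
          2 * (zeta p 1 ^ a.val - 1)) = 0 := by
  have h1m : 1 ≤ m := by omega
  set ψ := changeLevel (pow_dvd_pow p hcm) χc with hψ
  have hζ : IsPrimitiveRoot (zeta p m) (p ^ m) := isPrimitiveRoot_zeta p m
  have hne : ψ ≠ 1 := changeLevel_ne_one_of_isPrimitive (by omega) hcm χc hprim
  have hA : ∑ a : ZMod (p ^ m), ψ a *
      ∑ k ∈ range m, (-1 : PadicAlgCl p) ^ k * (zeta p (m - 2 * k) ^ a.val - 1) / (p : PadicAlgCl p) ^ k = 0 := by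
    simp_rw [twistedEll_eq_ellConj]
    rw [hψ]
    exact sum_changeLevel_mul_ellConj_eq_zero (by omega) hcm hodd χc hprim hζ
  have hB : ∑ a : ZMod (p ^ m), ψ a *
      ∑ k ∈ range m, (-1 : PadicAlgCl p) ^ k * (zeta p (m - 2 * k) ^ (-a).val - 1) / (p : PadicAlgCl p) ^ k = 0 := by
    rw [sum_mul_apply_neg_val ψ (fun x ↦ ∑ k ∈ range m,
      (-1 : PadicAlgCl p) ^ k * (zeta p (m - 2 * k) ^ x - 1) / (p : PadicAlgCl p) ^ k), hA, mul_zero]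
  have hC : ∑ a : ZMod (p ^ m), ψ a * (zeta p 1 ^ a.val - 1) = 0 := by
    simp_rw [mul_sub, Finset.sum_sub_distrib, mul_one, MulChar.sum_eq_zero_of_ne_one hne, sub_zero]
    rw [zeta_one_eq_pow h1m, hψ]
    exact sum_changeLevel_mul_pow_eq_zero_of_gt (by omega) hcm χc hprim hζ.pow_eq_one (by omega : m < m - 1 + c)
  have hsplit : ∀ a : ZMod (p ^ m), ψ a *
      (3 * ((∑ k ∈ range m, (-1 : PadicAlgCl p) ^ k * (zeta p (m - 2 * k) ^ a.val - 1) / (p : PadicAlgCl p) ^ k) +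
            ∑ k ∈ range m, (-1 : PadicAlgCl p) ^ k * (zeta p (m - 2 * k) ^ (-a).val - 1) / (p : PadicAlgCl p) ^ k) -
        2 * (zeta p 1 ^ a.val - 1)) =
      3 * (ψ a * ∑ k ∈ range m, (-1 : PadicAlgCl p) ^ k * (zeta p (m - 2 * k) ^ a.val - 1) / (p : PadicAlgCl p) ^ k) +
      3 * (ψ a * ∑ k ∈ range m, (-1 : PadicAlgCl p) ^ k * (zeta p (m - 2 * k) ^ (-a).val - 1) / (p : PadicAlgCl p) ^ k) -
      2 * (ψ a * (zeta p 1 ^ a.val - 1)) := fun a ↦ by ring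
  rw [Finset.sum_congr rfl fun a _ ↦ hsplit a, Finset.sum_sub_distrib, Finset.sum_add_distrib, ← Finset.mul_sum,
    ← Finset.mul_sum, ← Finset.mul_sum, hA, hB, hC]
  ring

/-- **Plus-logarithm character sum for the TRIVIAL character** (`m = 2k + 2` even): with `φ = φ(p^m)` and
`T = Σ_{a unit} σ_a(ℓ_m) = −φ·Σ_{i≤k} (−1)^i p^{−i}` (`sum_one_mul_ellConj_even`) and the Ramanujan sum `Σ_{a unit} ζ_1^a = −p^{m−1}`:
`Σ_a 𝟙(a)·(3(ℓ_m^{(a)} + ℓ_m^{(−a)}) − 2(ζ_1^a − 1)) = 6T + 2p^{m−1} + 2φ`. [cite: Kobayashi2003, proof of Thm. 6.3 (p. 25)] -/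
theorem sum_one_mul_plusLog_eq (k₀ : ℕ) :
    ∑ a : ZMod (p ^ (2 * k₀ + 2)), (1 : DirichletCharacter (PadicAlgCl p) (p ^ (2 * k₀ + 2))) a *
        (3 * ((∑ k ∈ range (2 * k₀ + 2),
                (-1 : PadicAlgCl p) ^ k * (zeta p (2 * k₀ + 2 - 2 * k) ^ a.val - 1) / (p : PadicAlgCl p) ^ k) +
              ∑ k ∈ range (2 * k₀ + 2),
                (-1 : PadicAlgCl p) ^ k * (zeta p (2 * k₀ + 2 - 2 * k) ^ (-a).val - 1) / (p : PadicAlgCl p) ^ k) -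
          2 * (zeta p 1 ^ a.val - 1)) =
      6 * (-(Nat.totient (p ^ (2 * k₀ + 2)) : PadicAlgCl p) * ∑ i ∈ range (k₀ + 1), (-1) ^ i / (p : PadicAlgCl p) ^ i) +
        2 * (p : PadicAlgCl p) ^ (2 * k₀ + 1) + 2 * (Nat.totient (p ^ (2 * k₀ + 2)) : PadicAlgCl p) := by
  set m := 2 * k₀ + 2 with hm
  set ψ : DirichletCharacter (PadicAlgCl p) (p ^ m) := 1 with hψ
  have hζ : IsPrimitiveRoot (zeta p m) (p ^ m) := isPrimitiveRoot_zeta p m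
  have hA : ∑ a : ZMod (p ^ m), ψ a *
      ∑ k ∈ range m, (-1 : PadicAlgCl p) ^ k * (zeta p (m - 2 * k) ^ a.val - 1) / (p : PadicAlgCl p) ^ k =
      -(Nat.totient (p ^ m) : PadicAlgCl p) * ∑ i ∈ range (k₀ + 1), (-1) ^ i / (p : PadicAlgCl p) ^ i := by
    simp_rw [twistedEll_eq_ellConj]
    exact sum_one_mul_ellConj_even hζ
  have hB : ∑ a : ZMod (p ^ m), ψ a *
      ∑ k ∈ range m, (-1 : PadicAlgCl p) ^ k * (zeta p (m - 2 * k) ^ (-a).val - 1) / (p : PadicAlgCl p) ^ k =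
      -(Nat.totient (p ^ m) : PadicAlgCl p) * ∑ i ∈ range (k₀ + 1), (-1) ^ i / (p : PadicAlgCl p) ^ i := by
    rw [sum_mul_apply_neg_val ψ (fun x ↦ ∑ k ∈ range m,
      (-1 : PadicAlgCl p) ^ k * (zeta p (m - 2 * k) ^ x - 1) / (p : PadicAlgCl p) ^ k), hA, hψ,
      MulChar.one_apply (isUnit_one.neg), one_mul]
  have hC : ∑ a : ZMod (p ^ m), ψ a * (zeta p 1 ^ a.val - 1) =
      -(p : PadicAlgCl p) ^ (m - 1) - (Nat.totient (p ^ m) : PadicAlgCl p) := by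
    simp_rw [mul_sub, Finset.sum_sub_distrib, mul_one]
    rw [hψ, MulChar.sum_one_eq_card_units, ZMod.card_units_eq_totient, zeta_one_eq_pow (by omega : 1 ≤ m),
      sum_one_mul_pow_eq_neg_of_eq (by omega : m - 1 + 1 = m) hζ]
  have hsplit : ∀ a : ZMod (p ^ m), ψ a *
      (3 * ((∑ k ∈ range m, (-1 : PadicAlgCl p) ^ k * (zeta p (m - 2 * k) ^ a.val - 1) / (p : PadicAlgCl p) ^ k) +
            ∑ k ∈ range m, (-1 : PadicAlgCl p) ^ k * (zeta p (m - 2 * k) ^ (-a).val - 1) / (p : PadicAlgCl p) ^ k) -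
        2 * (zeta p 1 ^ a.val - 1)) =
      3 * (ψ a * ∑ k ∈ range m, (-1 : PadicAlgCl p) ^ k * (zeta p (m - 2 * k) ^ a.val - 1) / (p : PadicAlgCl p) ^ k) +
      3 * (ψ a * ∑ k ∈ range m, (-1 : PadicAlgCl p) ^ k * (zeta p (m - 2 * k) ^ (-a).val - 1) / (p : PadicAlgCl p) ^ k) -
      2 * (ψ a * (zeta p 1 ^ a.val - 1)) := fun a ↦ by ring
  rw [Finset.sum_congr rfl fun a _ ↦ hsplit a, Finset.sum_sub_distrib, Finset.sum_add_distrib, ← Finset.mul_sum,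
    ← Finset.mul_sum, ← Finset.mul_sum, hA, hB, hC, show m - 1 = 2 * k₀ + 1 by omega]
  ring

end Summit.BirchSwinnertonDyer.BirchSwinnertonDyer.Theorems.SignedKatoOffTwo.HondaLogChi

end
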